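import Summits.NavierStokesRegularity.NavierStokesRegularity.Theorems.OddMorawetzOddMorawetzLocalRefutation

/-!
# Crux `MorawetzKillsTypeI` (stmt-NavierStokesRegularity-1377, route `OddMorawetz`) — PROVED

The crux decl `Theses.OddMorawetz.MorawetzKillsTypeI` ("an odd-weight `O(3)`-invariant Morawetz certificate of
derivative weight `k ≤ 5` kills Type-I blow-up") holds VACUOUSLY: by the landed reduction
`morawetzKillsTypeI_of_not_oddMorawetzLocal` (this crux's line, file `…MorawetzKillsTypeIReduction`) it follows from
the non-existence of any such certificate, `¬ OddMorawetzLocal`, which is the landed refutation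
`not_OddMorawetzLocal` of the sibling crux stmt-NavierStokesRegularity-1376 (file `…OddMorawetzLocalRefutation`:
parity and weight one, then the weight-3 and weight-5 classifications; the weight-3 half is also proved
independently along this line's isotropic route, `stub_isoStructureThree` / `stub_isoNullThree` /
`stub_isoAssembleThree`). Everything is proved; no definitions.
-/

-- the problem namespace `Summit.NavierStokesRegularity.NavierStokesRegularity` repeats the summit name by design (D-0017)
set_option linter.dupNamespace false

namespace Summit.NavierStokesRegularity.NavierStokesRegularity.Theorems

/-- **Crux `MorawetzKillsTypeI` (stmt-NavierStokesRegularity-1377).** For every `k ≤ 5`, every smooth, cubic,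
derivative-weight-`k`, odd (`k` odd forced by parity) local density `m` whose Euler pairing `Q` is a strict Morawetz
certificate, Type-I blow-up of classical Leray–Hopf solutions with rapidly decaying data is excluded — because no such
certificate exists (`not_OddMorawetzLocal`), via `morawetzKillsTypeI_of_not_oddMorawetzLocal`. -/
theorem MorawetzKillsTypeI_proof :
    Summit.NavierStokesRegularity.NavierStokesRegularity.Theses.OddMorawetz.MorawetzKillsTypeI :=
  morawetzKillsTypeI_of_not_oddMorawetzLocal not_OddMorawetzLocal

end Summit.NavierStokesRegularity.NavierStokesRegularity.Theorems
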